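import Summits.CriticalPhenomena.PercolationContinuityZ3.Theorems.SahiBoxTP2Submodular
import Summits.CriticalPhenomena.PercolationContinuityZ3.Theorems.SahiBoxTP2Transport
import Literature.MathematicalPhysics.QuantumLattice.LatticeScalarField
import Literature.Probability.LatticeModels.MTP2FourFunctions

/-!
# Ferromagnetic lattice field measures (arbitrary single-site law, scalar `φ⁴`) are box-TP₂: FKG, and `E_n ≥ 0` given `L(d,n)`

Support file of the Sahi cell (`prim-sahi`, typer seat, generation 13; `--supports stmt-CriticalPhenomena-4575`).
Theorems only (no definitions, no named facts, no sorries).  The continuous-spin counterpart of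
`SahiIsingBoxTP2.lean`.

The tree's scalar lattice fields on a finite graph `G` (`Literature.MathematicalPhysics.QuantumLattice.LatticeScalarField`,
Griffiths–Simon 1973 / Glimm–Jaffe §9.5 / Aizenman–Duminil-Copin 2021 §1.2):
`latticeFieldMeasure G ν J = Z⁻¹ exp (J ∑_{xy ∈ E(G)} φ_x φ_y) ∏_x dν(φ_x)` for ANY single-site law `ν` on `ℝ`, and the
lattice `φ⁴` measure `phi4Measure G g κ J = Z⁻¹ exp (−∑_x (g φ_x⁴ + κ φ_x²) + J ∑_{xy} φ_x φ_y) ∏_x dφ_x` (both as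
`Measure.tilted`).  For a FERROMAGNETIC coupling `J ≥ 0` the exponent is supermodular on the lattice `ℝ^V`
(`pairInteraction_supermodular`: `φ_x φ_y` is supermodular on `ℝ²`, single-site terms are modular), so the density is
MTP₂ with respect to the product reference measure and Karlin–Rinott's four functions theorem
(`Literature.Probability.LatticeModels.lintegral_four_functions`, any finite index set) gives:

* `IsBoxTP2.withDensity_pi_fintype`, `IsBoxTP2.tilted_pi_of_supermodular` — MTP₂ densities / exponential tilts by
  measurable supermodular functions of ANY σ-finite product reference measure on `ℝ^V` (`V` finite) are box-TP₂
  (generation 11's `IsBoxTP2.withDensity_pi(_exp_neg)` had `V = Fin d`; the two-point rearrangement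
  `mul_add_mul_le_sup_mul_sup_add_inf_mul_inf` is generation 11's).
* **`isBoxTP2_latticeFieldMeasure`** (`J ≥ 0`, any σ-finite `ν`, any finite graph) and **`isBoxTP2_phi4Measure`**
  (`J ≥ 0`, any `g, κ`): the ferromagnetic lattice field measures are box-TP₂.
* Transport `ℝ^V ≃o ℝ^{Fin |V|}` (`msahiE_nonneg_of_isBoxTP2_realFun`, bounded measurable monotone families, given
  `LiebSahiContinuum |V| n`; `integral_mul_integral_le_of_isBoxTP2_realFun` unconditionally) and the consequences:
  **`latticeFieldMeasure_integral_mul_integral_le`, `phi4Measure_integral_mul_integral_le` — the FKG inequality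
  for ferromagnetic lattice fields with arbitrary single-site distribution and for the lattice `φ⁴` field, all
  bounded measurable increasing `f, g`** (not previously in the tree), and `…_msahiE_nonneg` — Sahi positivity of
  order `n` given `L(|V|, n)` (⟸ `C_n`).

No sorries, no new axioms.
-/

noncomputable section

namespace Summit.CriticalPhenomena.PercolationContinuityZ3.Theorems.SahiBoxTP2

open MeasureTheory ProbabilityTheory Set Filter Topology Function Literature.Combinatorics.Sahi2008
open Literature.Probability.LatticeModels Literature.MathematicalPhysics.QuantumLattice
open scoped ENNReal

/-! ### MTP₂ densities and supermodular tilts of product measures on `ℝ^V`, `V` finite -/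

section Density

variable {V : Type*} [Fintype V]

/-- **MTP₂ densities give box-TP₂ laws on `ℝ^V`** (`V` any finite index set; ANY σ-finite product reference measure):
Karlin–Rinott's four functions theorem with the four functions `ρ·1_{box}`. [folklore; cite: KarlinRinott1980, Thm. 2.1] -/
theorem IsBoxTP2.withDensity_pi_fintype (μ : V → Measure ℝ) [∀ i, SigmaFinite (μ i)] (ρ : (V → ℝ) → ℝ≥0∞)
    (hρm : Measurable ρ) (hρ : ∀ x y, ρ x * ρ y ≤ ρ (x ⊔ y) * ρ (x ⊓ y)) :
    IsBoxTP2 ((Measure.pi μ).withDensity ρ) := by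
  intro a b a' b'
  rw [withDensity_apply _ measurableSet_Icc, withDensity_apply _ measurableSet_Icc,
    withDensity_apply _ measurableSet_Icc, withDensity_apply _ measurableSet_Icc, ← lintegral_indicator measurableSet_Icc,
    ← lintegral_indicator measurableSet_Icc, ← lintegral_indicator measurableSet_Icc,
    ← lintegral_indicator measurableSet_Icc, mul_comm (∫⁻ x, (Icc (a ⊓ a') (b ⊓ b')).indicator ρ x ∂Measure.pi μ)]
  refine Literature.Probability.LatticeModels.lintegral_four_functions μ _ _ _ _ (hρm.indicator measurableSet_Icc)
    (hρm.indicator measurableSet_Icc) (hρm.indicator measurableSet_Icc) (hρm.indicator measurableSet_Icc)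
    fun x y => ?_
  by_cases hx : x ∈ Icc a b
  · by_cases hy : y ∈ Icc a' b'
    · rw [indicator_of_mem hx, indicator_of_mem hy,
        indicator_of_mem (show x ⊔ y ∈ Icc (a ⊔ a') (b ⊔ b') from ⟨sup_le_sup hx.1 hy.1, sup_le_sup hx.2 hy.2⟩),
        indicator_of_mem (show x ⊓ y ∈ Icc (a ⊓ a') (b ⊓ b') from ⟨inf_le_inf hx.1 hy.1, inf_le_inf hx.2 hy.2⟩)]
      exact hρ x y
    · rw [indicator_of_notMem hy, mul_zero]
      exact zero_le
  · rw [indicator_of_notMem hx, zero_mul]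
    exact zero_le

/-- **Exponential tilts of product measures by measurable SUPERMODULAR functions are box-TP₂** (`μ.tilted f` is
`μ` with density `e^{f}/Z`; when `e^f` is not integrable the tilt is the zero measure, trivially box-TP₂).
[folklore] -/
theorem IsBoxTP2.tilted_pi_of_supermodular (μ : V → Measure ℝ) [∀ i, SigmaFinite (μ i)] {f : (V → ℝ) → ℝ}
    (hfm : Measurable f) (hf : ∀ x y, f x + f y ≤ f (x ⊔ y) + f (x ⊓ y)) :
    IsBoxTP2 ((Measure.pi μ).tilted f) := by
  set Z : ℝ := ∫ x, Real.exp (f x) ∂Measure.pi μ with hZ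
  have hZ0 : 0 ≤ Z := integral_nonneg fun x => (Real.exp_pos _).le
  refine IsBoxTP2.withDensity_pi_fintype μ _
    (ENNReal.measurable_ofReal.comp ((Real.measurable_exp.comp hfm).div_const Z)) fun x y => ?_
  rw [← ENNReal.ofReal_mul (div_nonneg (Real.exp_pos _).le hZ0),
    ← ENNReal.ofReal_mul (div_nonneg (Real.exp_pos _).le hZ0)]
  refine ENNReal.ofReal_le_ofReal ?_
  rw [div_mul_div_comm, div_mul_div_comm, ← Real.exp_add, ← Real.exp_add]
  exact div_le_div_of_nonneg_right (Real.exp_le_exp.2 (hf x y)) (mul_nonneg hZ0 hZ0)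

variable (G : SimpleGraph V) [DecidableRel G.Adj]

/-- **The nearest-neighbour pair interaction `∑_{xy ∈ E(G)} φ_x φ_y` is supermodular on `ℝ^V`.** [folklore] -/
theorem pairInteraction_supermodular (φ ψ : V → ℝ) :
    pairInteraction G φ + pairInteraction G ψ ≤ pairInteraction G (φ ⊔ ψ) + pairInteraction G (φ ⊓ ψ) := by
  unfold pairInteraction
  rw [← Finset.sum_add_distrib, ← Finset.sum_add_distrib]
  refine Finset.sum_le_sum fun e _ => ?_
  induction e using Sym2.ind with
  | h x y =>
    simp only [Sym2.lift_mk, Pi.sup_apply, Pi.inf_apply]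
    exact mul_add_mul_le_sup_mul_sup_add_inf_mul_inf (φ x) (ψ x) (φ y) (ψ y)

/-- **Ferromagnetic lattice field measures with ARBITRARY single-site law are box-TP₂**: for `J ≥ 0`, any σ-finite
`ν` on `ℝ` and any finite graph `G`, `latticeFieldMeasure G ν J = Z⁻¹ e^{J ∑_{xy} φ_x φ_y} ∏ dν(φ_x)` satisfies
`μ[a,b] μ[a',b'] ≤ μ[a ∧ a', b ∧ b'] μ[a ∨ a', b ∨ b']` for all order boxes of `ℝ^V`. [this work] -/
theorem isBoxTP2_latticeFieldMeasure (ν : Measure ℝ) [SigmaFinite ν] {J : ℝ} (hJ : 0 ≤ J) :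
    IsBoxTP2 (latticeFieldMeasure G ν J) :=
  IsBoxTP2.tilted_pi_of_supermodular (fun _ : V => ν) ((measurable_pairInteraction G).const_mul J) fun x y => by
    have h := pairInteraction_supermodular G x y
    nlinarith

/-- **The lattice `φ⁴` measure is box-TP₂** for a ferromagnetic coupling `J ≥ 0` (any `g, κ`, any finite graph):
`phi4Measure G g κ J = Z⁻¹ e^{−∑_x (g φ_x⁴ + κ φ_x²) + J ∑_{xy} φ_x φ_y} ∏ dφ_x`. [this work] -/
theorem isBoxTP2_phi4Measure (g κ : ℝ) {J : ℝ} (hJ : 0 ≤ J) : IsBoxTP2 (phi4Measure G g κ J) := by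
  have e : (volume : Measure (V → ℝ)) = Measure.pi fun _ : V => (volume : Measure ℝ) := rfl
  unfold phi4Measure
  rw [e]
  refine IsBoxTP2.tilted_pi_of_supermodular (fun _ : V => (volume : Measure ℝ)) (measurable_phi4Action G g κ J).neg
    fun x y => ?_
  have h := pairInteraction_supermodular G x y
  have hsite : ∑ v, (g * (x ⊔ y) v ^ 4 + κ * (x ⊔ y) v ^ 2) + ∑ v, (g * (x ⊓ y) v ^ 4 + κ * (x ⊓ y) v ^ 2) =
      ∑ v, (g * x v ^ 4 + κ * x v ^ 2) + ∑ v, (g * y v ^ 4 + κ * y v ^ 2) := by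
    rw [← Finset.sum_add_distrib, ← Finset.sum_add_distrib]
    refine Finset.sum_congr rfl fun v _ => ?_
    simp only [Pi.sup_apply, Pi.inf_apply]
    rcases le_total (x v) (y v) with hv | hv
    · rw [sup_eq_right.2 hv, inf_eq_left.2 hv]; ring
    · rw [sup_eq_left.2 hv, inf_eq_right.2 hv]
  simp only [phi4Action]
  nlinarith

end Density

/-! ### Sahi positivity on `ℝ^V`: transport to `ℝ^{Fin |V|}` -/

section Transport

variable {V : Type*} [Fintype V] {n : ℕ}

/-- **Given `LiebSahiContinuum |V| n`: every box-TP₂ probability measure on `ℝ^V` has `E_n(f_0,…,f_{n−1}) ≥ 0` for all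
bounded measurable nonnegative monotone `f_i`** (generation 11's `msahiE_nonneg_of_isBoxTP2_real` transported along the
coordinate relabelling `ℝ^V ≃o ℝ^{Fin |V|}`). [this work] -/
theorem msahiE_nonneg_of_isBoxTP2_realFun (hL : LiebSahiContinuum (Fintype.card V) n) (μ : Measure (V → ℝ))
    [IsProbabilityMeasure μ] (hμ : IsBoxTP2 μ) (f : Fin n → (V → ℝ) → ℝ) (hfm : ∀ i, Measurable (f i))
    (hf0 : ∀ i x, 0 ≤ f i x) {M : ℝ} (hfM : ∀ i x, f i x ≤ M) (hmono : ∀ i, Monotone (f i)) :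
    0 ≤ msahiE μ n f := by
  classical
  -- `E : ℝ^{Fin |V|} ≃ᵐ ℝ^V`, an order isomorphism
  set E : (Fin (Fintype.card V) → ℝ) ≃ᵐ (V → ℝ) :=
    MeasurableEquiv.piCongrLeft (fun _ : V => ℝ) (Fintype.equivFin V).symm with hE
  have hEmono : Monotone E := fun x y hxy v => by
    simp only [hE, MeasurableEquiv.piCongrLeft, MeasurableEquiv.coe_mk, Equiv.piCongrLeft_apply_eq_cast, cast_eq]
    exact hxy _
  have hEsmono : Monotone E.symm := fun x y hxy i => by
    simp only [hE, MeasurableEquiv.piCongrLeft, MeasurableEquiv.symm_mk, MeasurableEquiv.coe_mk,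
      Equiv.piCongrLeft_symm_apply]
    exact hxy _
  set eo : (V → ℝ) ≃o (Fin (Fintype.card V) → ℝ) := E.symm.toEquiv.toOrderIso hEsmono hEmono with heo
  have hν : IsBoxTP2 (μ.map E.symm) := hμ.map_orderIso eo E.symm.measurableEmbedding
  haveI : IsProbabilityMeasure (μ.map E.symm) :=
    Measure.isProbabilityMeasure_map E.symm.measurable.aemeasurable
  have hmp : MeasurePreserving E.symm μ (μ.map E.symm) := ⟨E.symm.measurable, rfl⟩
  have key := msahiE_nonneg_of_isBoxTP2_real hL (μ.map E.symm) hν (fun i => f i ∘ E)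
    (fun i => (hfm i).comp E.measurable) (fun i x => hf0 i _) (fun i x => hfM i _)
    fun i x y hxy => hmono i (hEmono hxy)
  rw [← msahiE_comp_measurePreserving hmp E.symm.measurableEmbedding n _] at key
  have e : (fun i => (f i ∘ E) ∘ E.symm) = f := by
    funext i x
    simp only [Function.comp_apply, MeasurableEquiv.apply_symm_apply]
  rwa [e] at key

/-- Decreasing families. [this work] -/
theorem msahiE_nonneg_of_isBoxTP2_realFun_antitone (hL : LiebSahiContinuum (Fintype.card V) n) (μ : Measure (V → ℝ))
    [IsProbabilityMeasure μ] (hμ : IsBoxTP2 μ) (f : Fin n → (V → ℝ) → ℝ) (hfm : ∀ i, Measurable (f i))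
    (hf0 : ∀ i x, 0 ≤ f i x) {M : ℝ} (hfM : ∀ i x, f i x ≤ M) (hanti : ∀ i, Antitone (f i)) :
    0 ≤ msahiE μ n f := by
  classical
  set E : (Fin (Fintype.card V) → ℝ) ≃ᵐ (V → ℝ) :=
    MeasurableEquiv.piCongrLeft (fun _ : V => ℝ) (Fintype.equivFin V).symm with hE
  have hEmono : Monotone E := fun x y hxy v => by
    simp only [hE, MeasurableEquiv.piCongrLeft, MeasurableEquiv.coe_mk, Equiv.piCongrLeft_apply_eq_cast, cast_eq]
    exact hxy _
  have hEsmono : Monotone E.symm := fun x y hxy i => by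
    simp only [hE, MeasurableEquiv.piCongrLeft, MeasurableEquiv.symm_mk, MeasurableEquiv.coe_mk,
      Equiv.piCongrLeft_symm_apply]
    exact hxy _
  set eo : (V → ℝ) ≃o (Fin (Fintype.card V) → ℝ) := E.symm.toEquiv.toOrderIso hEsmono hEmono with heo
  have hν : IsBoxTP2 (μ.map E.symm) := hμ.map_orderIso eo E.symm.measurableEmbedding
  haveI : IsProbabilityMeasure (μ.map E.symm) :=
    Measure.isProbabilityMeasure_map E.symm.measurable.aemeasurable
  have hmp : MeasurePreserving E.symm μ (μ.map E.symm) := ⟨E.symm.measurable, rfl⟩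
  have key := msahiE_nonneg_of_isBoxTP2_real_antitone hL (μ.map E.symm) hν (fun i => f i ∘ E)
    (fun i => (hfm i).comp E.measurable) (fun i x => hf0 i _) (fun i x => hfM i _)
    fun i x y hxy => hanti i (hEmono hxy)
  rw [← msahiE_comp_measurePreserving hmp E.symm.measurableEmbedding n _] at key
  have e : (fun i => (f i ∘ E) ∘ E.symm) = f := by
    funext i x
    simp only [Function.comp_apply, MeasurableEquiv.apply_symm_apply]
  rwa [e] at key

/-- From `C_n`. [this work; cite: Sahi2008, Conj. 5 (p. 212); LiebSahi2021, Conj. 1.1] -/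
theorem msahiE_nonneg_of_isBoxTP2_realFun_of_sahiConjecture (hC : SahiConjecture n) (μ : Measure (V → ℝ))
    [IsProbabilityMeasure μ] (hμ : IsBoxTP2 μ) (f : Fin n → (V → ℝ) → ℝ) (hfm : ∀ i, Measurable (f i))
    (hf0 : ∀ i x, 0 ≤ f i x) {M : ℝ} (hfM : ∀ i x, f i x ≤ M) (hmono : ∀ i, Monotone (f i)) :
    0 ≤ msahiE μ n f :=
  msahiE_nonneg_of_isBoxTP2_realFun ((sahiConjecture_iff_forall_liebSahiContinuum n).1 hC _) μ hμ f hfm hf0 hfM hmono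

/-- **Unconditionally: the FKG inequality for box-TP₂ probability measures on `ℝ^V`**, bounded measurable nonnegative
monotone `f, g`. [this work] -/
theorem integral_mul_integral_le_of_isBoxTP2_realFun (μ : Measure (V → ℝ)) [IsProbabilityMeasure μ] (hμ : IsBoxTP2 μ)
    {f g : (V → ℝ) → ℝ} (hfm : Measurable f) (hgm : Measurable g) (hf0 : ∀ x, 0 ≤ f x) (hg0 : ∀ x, 0 ≤ g x) {M : ℝ}
    (hfM : ∀ x, f x ≤ M) (hgM : ∀ x, g x ≤ M) (hf : Monotone f) (hg : Monotone g) :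
    (∫ x, f x ∂μ) * (∫ x, g x ∂μ) ≤ ∫ x, f x * g x ∂μ := by
  have h := msahiE_nonneg_of_isBoxTP2_realFun (liebSahiContinuum_of_order_le_two _ le_rfl) μ hμ ![f, g]
    (fun i => by fin_cases i <;> assumption) (fun i => by fin_cases i <;> assumption) (M := M)
    (fun i => by fin_cases i <;> assumption) (fun i => by fin_cases i <;> assumption)
  rw [msahiE_two] at h
  linarith

end Transport

/-! ### The theorems for the lattice field measures -/

section Fields

variable {V : Type*} [Fintype V] (G : SimpleGraph V) [DecidableRel G.Adj] {n : ℕ}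

/-- **FKG FOR FERROMAGNETIC LATTICE FIELDS WITH ARBITRARY SINGLE-SITE LAW** (Griffiths–Simon / Aizenman–Duminil-Copin
framework): for `J ≥ 0`, a σ-finite single-site law `ν` making `latticeFieldMeasure G ν J` a probability measure, and
bounded measurable nonnegative increasing `f, g` on `ℝ^V`: `∫ f ∫ g ≤ ∫ f g`. [this work] -/
theorem latticeFieldMeasure_integral_mul_integral_le (ν : Measure ℝ) [SigmaFinite ν] {J : ℝ} (hJ : 0 ≤ J)
    [IsProbabilityMeasure (latticeFieldMeasure G ν J)] {f g : (V → ℝ) → ℝ} (hfm : Measurable f)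
    (hgm : Measurable g) (hf0 : ∀ x, 0 ≤ f x) (hg0 : ∀ x, 0 ≤ g x) {M : ℝ} (hfM : ∀ x, f x ≤ M)
    (hgM : ∀ x, g x ≤ M) (hf : Monotone f) (hg : Monotone g) :
    (∫ x, f x ∂latticeFieldMeasure G ν J) * (∫ x, g x ∂latticeFieldMeasure G ν J) ≤
      ∫ x, f x * g x ∂latticeFieldMeasure G ν J :=
  integral_mul_integral_le_of_isBoxTP2_realFun _ (isBoxTP2_latticeFieldMeasure G ν hJ) hfm hgm hf0 hg0 hfM hgM hf hg

/-- **Given `L(|V|, n)` (⟸ `C_n`): ferromagnetic lattice fields with arbitrary single-site law are Sahi-positive of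
order `n`** for bounded measurable nonnegative increasing families. [this work] -/
theorem latticeFieldMeasure_msahiE_nonneg (hL : LiebSahiContinuum (Fintype.card V) n) (ν : Measure ℝ)
    [SigmaFinite ν] {J : ℝ} (hJ : 0 ≤ J) [IsProbabilityMeasure (latticeFieldMeasure G ν J)]
    (f : Fin n → (V → ℝ) → ℝ) (hfm : ∀ i, Measurable (f i)) (hf0 : ∀ i x, 0 ≤ f i x) {M : ℝ}
    (hfM : ∀ i x, f i x ≤ M) (hmono : ∀ i, Monotone (f i)) : 0 ≤ msahiE (latticeFieldMeasure G ν J) n f :=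
  msahiE_nonneg_of_isBoxTP2_realFun hL _ (isBoxTP2_latticeFieldMeasure G ν hJ) f hfm hf0 hfM hmono

/-- **FKG FOR THE LATTICE `φ⁴` FIELD** (`J ≥ 0`, any `g, κ` making it a probability measure — e.g. `g > 0`): for
bounded measurable nonnegative increasing `f, g`, `∫ f ∫ g ≤ ∫ f g`. [this work] -/
theorem phi4Measure_integral_mul_integral_le (g₄ κ : ℝ) {J : ℝ} (hJ : 0 ≤ J)
    [IsProbabilityMeasure (phi4Measure G g₄ κ J)] {f g : (V → ℝ) → ℝ} (hfm : Measurable f) (hgm : Measurable g)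
    (hf0 : ∀ x, 0 ≤ f x) (hg0 : ∀ x, 0 ≤ g x) {M : ℝ} (hfM : ∀ x, f x ≤ M) (hgM : ∀ x, g x ≤ M) (hf : Monotone f)
    (hg : Monotone g) :
    (∫ x, f x ∂phi4Measure G g₄ κ J) * (∫ x, g x ∂phi4Measure G g₄ κ J) ≤ ∫ x, f x * g x ∂phi4Measure G g₄ κ J :=
  integral_mul_integral_le_of_isBoxTP2_realFun _ (isBoxTP2_phi4Measure G g₄ κ hJ) hfm hgm hf0 hg0 hfM hgM hf hg

/-- **Given `L(|V|, n)` (⟸ `C_n`): the lattice `φ⁴` field is Sahi-positive of order `n`** for bounded measurable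
nonnegative increasing families. [this work] -/
theorem phi4Measure_msahiE_nonneg (hL : LiebSahiContinuum (Fintype.card V) n) (g κ : ℝ) {J : ℝ} (hJ : 0 ≤ J)
    [IsProbabilityMeasure (phi4Measure G g κ J)] (f : Fin n → (V → ℝ) → ℝ) (hfm : ∀ i, Measurable (f i))
    (hf0 : ∀ i x, 0 ≤ f i x) {M : ℝ} (hfM : ∀ i x, f i x ≤ M) (hmono : ∀ i, Monotone (f i)) :
    0 ≤ msahiE (phi4Measure G g κ J) n f :=
  msahiE_nonneg_of_isBoxTP2_realFun hL _ (isBoxTP2_phi4Measure G g κ hJ) f hfm hf0 hfM hmono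

/-- The `φ⁴` field, from `C_n`. [this work; cite: Sahi2008, Conj. 5 (p. 212); LiebSahi2021, Conj. 1.1] -/
theorem phi4Measure_msahiE_nonneg_of_sahiConjecture (hC : SahiConjecture n) (g κ : ℝ) {J : ℝ} (hJ : 0 ≤ J)
    [IsProbabilityMeasure (phi4Measure G g κ J)] (f : Fin n → (V → ℝ) → ℝ) (hfm : ∀ i, Measurable (f i))
    (hf0 : ∀ i x, 0 ≤ f i x) {M : ℝ} (hfM : ∀ i x, f i x ≤ M) (hmono : ∀ i, Monotone (f i)) :
    0 ≤ msahiE (phi4Measure G g κ J) n f :=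
  phi4Measure_msahiE_nonneg G ((sahiConjecture_iff_forall_liebSahiContinuum n).1 hC _) g κ hJ f hfm hf0 hfM hmono

end Fields

end Summit.CriticalPhenomena.PercolationContinuityZ3.Theorems.SahiBoxTP2
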